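import Literature.AlgebraicGeometry.Frobenioids.Thm42Sub
import Literature.AlgebraicGeometry.Frobenioids.PerfFactorialWeak
import HarnessLib

/-!
# [FrdI] Theorem 4.2 / 4.9: the setting of the printed proof for WEAKLY perf-factorial divisor monoids

Mochizuki, *The geometry of Frobenioids I: the general theory*, Kyushu J. Math. **62** (2008)
293–400, §4, Theorem 4.2, proof p. 78 ll. 28–46 ("we may assume … not of group-like type … by passing to
the perfections … of perfect type") [cite: MochizukiFrdI2008, Thm. 4.2 p.78]; Definition 2.4 (i) p. 47
[cite: MochizukiFrdI2008, Def. 2.4(i) p.47].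

DEFINITION file (cell abc-iut, layer L1, seat abc-iut-L1-t14; row «C411iii/iv-WEAK» = the [FrdI] Thm. 4.9 /
Cor. 4.11 (iii)(iv) chain over `IsPerfFactorialWeak`, block (Σ)). The frozen structure of HYPOTHESES
`FrdI.T42.Setting F₁ F₂ Ψ` of `Thm42Sub.lean` (the setting of the proof of Thm. 4.2 after its two printed
reductions, over which the tree's kernel proofs of Thm. 4.2 (ii)(iii) and Thm. 4.9 are written — 42 theorems of
the Thm. 4.9 chain take `S : T42.Setting F₁ F₂ Ψ`) carries the two fields `perfFactorial₁/₂ : Objectwise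
IsPerfFactorial Φ_i` (Def. 2.4 (i) (a)–(d) as printed). Cell finding F-L2d2-1: condition (d) FAILS for the
divisor monoids `Φ₀(Y^log) ⊇ ∏_J ℤ_{≥0}` of [EtTh] §3 at coverings with infinitely many special-fibre components
(kernel witness `PerfFactorialProductCounterexample.not_isPerfFactorial_multiplicative_pi_nat`), where [EtTh]
Cor. 3.8 (iii) / Prop. 5.3 quote [FrdI] Thm. 4.9 and [IUTchI] Def. 3.6 (a) quotes Cor. 4.11 (iv). The cell's
named weakening `IsPerfFactorialWeak` = (a)(b)(c) + (d_ord) + (d_res) (`PerfFactorialWeak.lean`, seat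
abc-iut-L1-t2) is what every step of the chain actually consumes (kernel-level dependency trace of seat
abc-iut-L1-t14, HOME/staging/L1/L1-t14/g5/C411iii-iv-WEAK-TRACE.md: of the 2 337 declarations in the cone of the
Cor. 4.11 (iii)(iv) closers, exactly 3 use (d), all through (d_ord)/(d_res)).

This file DEFINES the weak-hypothesis twin of the setting and nothing else (STATEMENT-ONLY):
* `FrdI.T42.SettingWeak F₁ F₂ Ψ` — `T42.Setting` VERBATIM with `perfFactorial₁/₂` weakened to
  `Objectwise IsPerfFactorialWeak Φ_i` (same field names, so that the Thm. 4.9 chain re-threads by changing the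
  hypothesis type only).
The printed case `FrdI.T42.Setting.weak : Setting F₁ F₂ Ψ → SettingWeak F₁ F₂ Ψ` (via `IsPerfFactorial.weak`), the
symmetry `SettingWeak.symm` and the Setting-level lemmas of the chain live in the proof-only companion
`Thm42SubWeakBasic.lean`.

`T42.Setting` itself is untouched. No instance, no notation, nothing printed restated as if corrected; nothing here
is specific to the abc programme and no side is taken on [IUTchIII] Cor. 3.12.
-/

namespace Literature.AlgebraicGeometry.Frobenioids

open CategoryTheory Opposite

namespace FrdI.T42

universe w v v' u u'

variable {D₁ : Type u} [Category.{v} D₁] {Φ₁ : D₁ᵒᵖ ⥤ CommMonCat.{w}} {C₁ : Type u'} [Category.{v'} C₁]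
  {D₂ : Type u} [Category.{v} D₂] {Φ₂ : D₂ᵒᵖ ⥤ CommMonCat.{w}} {C₂ : Type u'} [Category.{v'} C₂]

/-- **Setting of the proof of Thm. 4.2 after its two reductions, for WEAKLY perf-factorial `Φ_i`** (p. 78
ll. 28–46): `C_i → F_{Φ_i}` Frobenioids of PERFECT and isotropic type with `Φ_i` weakly perf-factorial
(Def. 2.4 (i) (a)(b)(c) + (d_ord) + (d_res), `IsPerfFactorialWeak`), an equivalence `Ψ : C₁ ≌ C₂`, and the
conclusions of Thm. 3.4 (ii)(iii) for `Ψ` and its quasi-inverse recorded as fields — the structure of HYPOTHESES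
`T42.Setting` verbatim with the two monoid fields weakened. [cite: MochizukiFrdI2008, Thm. 4.2 p.78] -/
structure SettingWeak (F₁ : C₁ ⥤ ElemFrobenioid Φ₁) (F₂ : C₂ ⥤ ElemFrobenioid Φ₂) (Ψ : C₁ ≌ C₂) : Prop where
  /-- `C₁` is a Frobenioid -/
  isFrobenioid₁ : PreFrobenioid.IsFrobenioid F₁
  /-- `C₂` is a Frobenioid -/
  isFrobenioid₂ : PreFrobenioid.IsFrobenioid F₂
  /-- of perfect type (after "passing to the perfections") -/
  perfect₁ : PreFrobenioid.IsOfPerfectType F₁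
  /-- of perfect type -/
  perfect₂ : PreFrobenioid.IsOfPerfectType F₂
  /-- of isotropic type (hypothesis of Thm. 4.2) -/
  isotropic₁ : PreFrobenioid.IsOfIsotropicType F₁
  /-- of isotropic type -/
  isotropic₂ : PreFrobenioid.IsOfIsotropicType F₂
  /-- `Φ₁` weakly perf-factorial (Def. 2.4 (i) (a)(b)(c) + (d_ord) + (d_res)) -/
  perfFactorial₁ : Objectwise (fun M _ => IsPerfFactorialWeak M) Φ₁
  /-- `Φ₂` weakly perf-factorial -/
  perfFactorial₂ : Objectwise (fun M _ => IsPerfFactorialWeak M) Φ₂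
  /-- Thm. 3.4 (ii): `Ψ` preserves pre-steps -/
  preStep_map : ∀ ⦃X Y : C₁⦄ (φ : X ⟶ Y),
    PreFrobenioid.IsPreStep F₁ φ → PreFrobenioid.IsPreStep F₂ (Ψ.functor.map φ)
  /-- Thm. 3.4 (ii) for the quasi-inverse -/
  preStep_inv : ∀ ⦃X Y : C₂⦄ (φ : X ⟶ Y),
    PreFrobenioid.IsPreStep F₂ φ → PreFrobenioid.IsPreStep F₁ (Ψ.inverse.map φ)
  /-- steps are preserved (pre-steps + reflection of isomorphisms) -/
  step_map : ∀ ⦃X Y : C₁⦄ (φ : X ⟶ Y),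
    PreFrobenioid.IsStep F₁ φ → PreFrobenioid.IsStep F₂ (Ψ.functor.map φ)
  /-- steps, quasi-inverse -/
  step_inv : ∀ ⦃X Y : C₂⦄ (φ : X ⟶ Y),
    PreFrobenioid.IsStep F₂ φ → PreFrobenioid.IsStep F₁ (Ψ.inverse.map φ)
  /-- Thm. 3.4 (iii): morphisms of Frobenius type are preserved -/
  frobeniusType_map : ∀ ⦃X Y : C₁⦄ (φ : X ⟶ Y),
    PreFrobenioid.IsFrobeniusType F₁ φ → PreFrobenioid.IsFrobeniusType F₂ (Ψ.functor.map φ)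
  /-- Thm. 3.4 (iii), quasi-inverse -/
  frobeniusType_inv : ∀ ⦃X Y : C₂⦄ (φ : X ⟶ Y),
    PreFrobenioid.IsFrobeniusType F₂ φ → PreFrobenioid.IsFrobeniusType F₁ (Ψ.inverse.map φ)
  /-- Thm. 3.4 (iii): Frobenius degrees are preserved (`Ψ^{ℕ≥1} = id`, non-group-like case) -/
  degFr_map : ∀ ⦃X Y : C₁⦄ (φ : X ⟶ Y), PreFrobenioid.degFr F₂ (Ψ.functor.map φ) = PreFrobenioid.degFr F₁ φ
  /-- Thm. 3.4 (iii): pull-back morphisms are preserved -/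
  pullback_map : ∀ ⦃X Y : C₁⦄ (φ : X ⟶ Y),
    PreFrobenioid.IsPullbackMorphism F₁ φ → PreFrobenioid.IsPullbackMorphism F₂ (Ψ.functor.map φ)
  /-- Thm. 3.4 (iii), quasi-inverse -/
  pullback_inv : ∀ ⦃X Y : C₂⦄ (φ : X ⟶ Y),
    PreFrobenioid.IsPullbackMorphism F₂ φ → PreFrobenioid.IsPullbackMorphism F₁ (Ψ.inverse.map φ)

end FrdI.T42

end Literature.AlgebraicGeometry.Frobenioids
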